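import Literature.AlgebraicTopology.SingularHomology.FiniteDeckTransferPullback
import Literature.AlgebraicTopology.SingularHomology.CupProduct
import HarnessLib

/-!
# The transfer of a finite regular covering, III: the projection formula `τ^*(p^* a ⌣ b) = a ⌣ τ^* b`

Complements to `FiniteDeckTransfer` / `FiniteDeckTransferPullback` (A. Hatcher, *Algebraic Topology*
(2002), §3.G p. 321: the transfer `τ` of an `n`-sheeted covering `π : X̃ → X`, `τ^* : Hᵏ(X̃; R) → Hᵏ(X; R)`;
there: `τ^* π^* = |G|`, `π^* τ^* = Σ_g g^*`).  Here, for a finite regular covering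
`c : FiniteDeckCover G E B` (deck group `G`) and any commutative coefficient ring `R`, the transfer is a
homomorphism of `H^*(B; R)`-MODULES («projection formula»), on cochains and in cohomology:

* `FiniteDeckCover.transferCochain_cochainCup_map_left` — **`τ(p^♯φ ⌣ ψ) = φ ⌣ τψ`** on cochains;
  `FiniteDeckCover.transferCochain_cochainCup_map_right` — **`τ(ψ ⌣ p^♯φ) = τψ ⌣ φ`** (the sum over the
  `|G|` lifts `g ∘ a` of `σ = p ∘ a`: the front face of `g ∘ a` lies over the front face of `σ`, and
  `g ∘ a ↦` its back face is the orbit of the back face of `a`; the two-sheeted case is the tree's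
  `DoubleCover.transferCochain_cochainCup_map`);
* `FiniteDeckCover.transferMap_cupProduct_map_left` — **`τ^*(p^* a ⌣ b) = a ⌣ τ^* b`** and
  `FiniteDeckCover.transferMap_cupProduct_map_right` — **`τ^*(b ⌣ p^* a) = τ^* b ⌣ a`** in `H^*(–; R)`.

This is the algebraic-topology half of the ADJOINTNESS of correspondence (Hecke) operators `τ^* ∘ f₂^*`
for cup-product pairings (`⟨τ^* x, y⟩_B = ⟨x, p^* y⟩_E` once traces are matched), the hypothesis `hadj`
of `Literature.AlgebraicGeometry.Motives.HodgeStructure.Polarization.isSemisimple_apply`; written for the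
cell `pub-hodgecm2` (count-neutral).  All proved; no named facts, no definitions, no instances.

## References

* [HatcherAT2002] A. Hatcher, Algebraic Topology, CUP 2002, §3.G p. 321 (transfer homomorphisms),
  §3.2 p. 206 and Prop. 3.10 (cup product, naturality).
-/

noncomputable section

open CategoryTheory

universe u v w

namespace Literature.AlgebraicTopology.SingularHomology

namespace FiniteDeckCover

variable {G : Type w} [Group G] [Fintype G] {E B : Type u} [TopologicalSpace E] [TopologicalSpace B]
  [MulAction G E] (c : FiniteDeckCover G E B) {R : Type v} [CommRing R] {p q n : ℕ}

/-! ### The projection formula on cochains -/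

/-- **Projection formula on cochains, pull-back on the left: `τ(p^♯φ ⌣ ψ) = φ ⌣ τψ`.**  Evaluate at
`σ = p ∘ a`: `τ(p^♯φ ⌣ ψ)(σ) = Σ_g φ(p ∘ (g ∘ a)|front) ψ((g ∘ a)|back) = φ(σ|front) Σ_g ψ(g ∘ (a|back))
= (φ ⌣ τψ)(σ)` (front/back faces commute with push-forward; the lifts of `σ|back` are the `g ∘ (a|back)`).
[cite: HatcherAT2002, §3.G p. 321 and §3.2 p. 206] -/
theorem transferCochain_cochainCup_map_left (h : p + q = n) (φ : SingularSimplex B p → R)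
    (ψ : SingularSimplex E q → R) :
    c.transferCochain n (cochainCup h ((singularCochainComplex.map R R c.proj).f p φ) ψ) =
      cochainCup h φ (c.transferCochain q ψ) := by
  funext σ
  obtain ⟨a, rfl⟩ := c.map_proj_surjective σ
  change c.transferCochain n _ (a.map c.proj) = cochainCup h φ (c.transferCochain q ψ) (a.map c.proj)
  rw [transferCochain_apply_map_proj, cochainCup_apply, SingularSimplex.frontFace_map,
    SingularSimplex.backFace_map, transferCochain_apply_map_proj, orbitSum, orbitSum, Finset.mul_sum]
  refine Finset.sum_congr rfl fun g _ => ?_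
  rw [cochainCup_apply, SingularSimplex.frontFace_map, SingularSimplex.backFace_map,
    singularCochainComplex.map_apply, c.map_deck_map_proj]

/-- **Projection formula on cochains, pull-back on the right: `τ(ψ ⌣ p^♯φ) = τψ ⌣ φ`** (the general
finite regular covering; two sheets: `DoubleCover.transferCochain_cochainCup_map`).
[cite: HatcherAT2002, §3.G p. 321 and §3.2 p. 206] -/
theorem transferCochain_cochainCup_map_right (h : p + q = n) (ψ : SingularSimplex E p → R)
    (φ : SingularSimplex B q → R) :
    c.transferCochain n (cochainCup h ψ ((singularCochainComplex.map R R c.proj).f q φ)) =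
      cochainCup h (c.transferCochain p ψ) φ := by
  funext σ
  obtain ⟨a, rfl⟩ := c.map_proj_surjective σ
  change c.transferCochain n _ (a.map c.proj) = cochainCup h (c.transferCochain p ψ) φ (a.map c.proj)
  rw [transferCochain_apply_map_proj, cochainCup_apply, SingularSimplex.frontFace_map,
    SingularSimplex.backFace_map, transferCochain_apply_map_proj, orbitSum, orbitSum, Finset.sum_mul]
  refine Finset.sum_congr rfl fun g _ => ?_
  rw [cochainCup_apply, SingularSimplex.frontFace_map, SingularSimplex.backFace_map,
    singularCochainComplex.map_apply, c.map_deck_map_proj]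

/-! ### The projection formula in cohomology -/

/-- **Projection formula: `τ^*(p^* a ⌣ b) = a ⌣ τ^* b`** in `Hⁿ(B; R)` for `a ∈ Hᵖ(B; R)`,
`b ∈ Hᵠ(E; R)` — the transfer is left `H^*(B; R)`-linear (computed on representing cocycles,
`τ^*[z] = [τ z]` by naturality of `homologyπ`, then `transferCochain_cochainCup_map_left`). [cite: HatcherAT2002, §3.G p. 321 and Prop. 3.10] -/
theorem transferMap_cupProduct_map_left (h : p + q = n) (a : singularCohomology R R B p)
    (b : singularCohomology R R E q) :
    c.transferMap n (cupProduct h (singularCohomology.map R R c.proj p a) b) =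
      cupProduct h a (c.transferMap q b) := by
  induction a using singularCohomology_induction_on with
  | h a =>
  induction b using singularCohomology_induction_on with
  | h b =>
    -- `τ^*[z] = [τ z]` and its underlying cochain (naturality of `homologyπ`, `cyclesMap_i`)
    have hπ : ∀ {k : ℕ} (z : singularCochainComplex.cocycles R R E k),
        c.transferMap k (singularCohomology.π R R E k z) =
          singularCohomology.π R R B k (HomologicalComplex.cyclesMap c.transfer k z) := fun z => by
      change ((singularCochainComplex R R E).homologyπ _ ≫ HomologicalComplex.homologyMap c.transfer _) z =
        (HomologicalComplex.cyclesMap c.transfer _ ≫ (singularCochainComplex R R B).homologyπ _) z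
      rw [HomologicalComplex.homologyπ_naturality]
    have hi : ∀ {k : ℕ} (z : singularCochainComplex.cocycles R R E k),
        singularCochainComplex.iCocycles R R B k (HomologicalComplex.cyclesMap c.transfer k z) =
          c.transfer.f k (singularCochainComplex.iCocycles R R E k z) := fun z => by
      change (HomologicalComplex.cyclesMap c.transfer _ ≫ singularCochainComplex.iCocycles R R B _) z =
        (singularCochainComplex.iCocycles R R E _ ≫ c.transfer.f _) z
      rw [HomologicalComplex.cyclesMap_i]
    rw [singularCohomology.map_π, cupProduct_π_π, hπ, hπ, cupProduct_π_π]
    congr 1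
    refine singularCochainComplex.cocycles_ext ?_
    rw [hi, singularCochainComplex.iCocycles_cocyclesCup,
      singularCochainComplex.iCocycles_cocyclesCup, singularCochainComplex.iCocycles_cocyclesMap, hi]
    exact c.transferCochain_cochainCup_map_left h _ _

/-- **Projection formula: `τ^*(b ⌣ p^* a) = τ^* b ⌣ a`** in `Hⁿ(B; R)` for `b ∈ Hᵖ(E; R)`,
`a ∈ Hᵠ(B; R)` — the transfer is right `H^*(B; R)`-linear. [cite: HatcherAT2002, §3.G p. 321 and Prop. 3.10] -/
theorem transferMap_cupProduct_map_right (h : p + q = n) (b : singularCohomology R R E p)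
    (a : singularCohomology R R B q) :
    c.transferMap n (cupProduct h b (singularCohomology.map R R c.proj q a)) =
      cupProduct h (c.transferMap p b) a := by
  induction a using singularCohomology_induction_on with
  | h a =>
  induction b using singularCohomology_induction_on with
  | h b =>
    -- `τ^*[z] = [τ z]` and its underlying cochain (naturality of `homologyπ`, `cyclesMap_i`)
    have hπ : ∀ {k : ℕ} (z : singularCochainComplex.cocycles R R E k),
        c.transferMap k (singularCohomology.π R R E k z) =
          singularCohomology.π R R B k (HomologicalComplex.cyclesMap c.transfer k z) := fun z => by
      change ((singularCochainComplex R R E).homologyπ _ ≫ HomologicalComplex.homologyMap c.transfer _) z =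
        (HomologicalComplex.cyclesMap c.transfer _ ≫ (singularCochainComplex R R B).homologyπ _) z
      rw [HomologicalComplex.homologyπ_naturality]
    have hi : ∀ {k : ℕ} (z : singularCochainComplex.cocycles R R E k),
        singularCochainComplex.iCocycles R R B k (HomologicalComplex.cyclesMap c.transfer k z) =
          c.transfer.f k (singularCochainComplex.iCocycles R R E k z) := fun z => by
      change (HomologicalComplex.cyclesMap c.transfer _ ≫ singularCochainComplex.iCocycles R R B _) z =
        (singularCochainComplex.iCocycles R R E _ ≫ c.transfer.f _) z
      rw [HomologicalComplex.cyclesMap_i]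
    rw [singularCohomology.map_π, cupProduct_π_π, hπ, hπ, cupProduct_π_π]
    congr 1
    refine singularCochainComplex.cocycles_ext ?_
    rw [hi, singularCochainComplex.iCocycles_cocyclesCup,
      singularCochainComplex.iCocycles_cocyclesCup, singularCochainComplex.iCocycles_cocyclesMap, hi]
    exact c.transferCochain_cochainCup_map_right h _ _

/-- **`τ^*(p^* a) ⌣`-form of `τ^* p^* = |G|`, multiplicatively: `τ^*(p^* a ⌣ p^* a') = |G| • (a ⌣ a')`**
(projection formula with `b = p^* a'`, then `τ^* p^* a' = |G| • a'`). [cite: HatcherAT2002, §3.G p. 321 and Prop. 3.10] -/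
theorem transferMap_cupProduct_map_map (h : p + q = n) (a : singularCohomology R R B p)
    (a' : singularCohomology R R B q) :
    c.transferMap n (cupProduct h (singularCohomology.map R R c.proj p a)
      (singularCohomology.map R R c.proj q a')) = (Fintype.card G) • cupProduct h a a' := by
  rw [transferMap_cupProduct_map_left, transferMap_map, map_nsmul]

end FiniteDeckCover

end Literature.AlgebraicTopology.SingularHomology

end
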